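import Summits.FinalStateConjecture.FinalStateConjecture.Theorems.TameExitsLocalise.Negative.TameExitsLocaliseFalseOfExistsIncurableTameExit
import Summits.FinalStateConjecture.FinalStateConjecture.Cruxes.TameExitsLocalise.Lines.IdeatorK2Sketch
import HarnessLib

/-!
# Disproof of `TameExitsLocalise` (crux B, stmt-FinalStateConjecture-16894) — findings

cdisprove seat `refuter-cdisprove-stmt-FinalStateConjecture-16894-g2-0` (gen 2). `B := TameExitsLocalise`,
`S := FinalStateConjecture`, `A := LaminatedThreshold`; `Good`, `NoKillingTail`, `ParametricTailGluing`,
`GoodnessTailRobust`, `KillingTailCase` are the birth line's vocabulary (`Cruxes/…/Lines/birth.lean`),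
`BadnessTransfer` the picked line's (`Lines/IdeatorK2Sketch.lean`). Everything below is kernel-checked except the one
`sorry` of §6 (the construction target itself). FINDINGS:

1. **No unconditional kill is possible in the tree today** (§6): every refutation of B needs a datum PROVED good
   (B's hypothesis asks for good members) or a use of S; no admissible datum is provably good or provably exceptional
   in Lean (MGHD existence, Cauchy stability, Christodoulou–Klainerman are not formalised). No junk model exists:
   `ChartedSpace E3 X` + `ConnectedSpace X` force an honest non-empty 3-manifold, `HasLeviCivita` is an honest `Fact`,
   `IsMaximal` quantifies over the repaired `VacuumCauchyDevelopment` (audit g6).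
2. **B ∧ S is compactly supported ("local-kick") genericity** (§1, `lkg_of_B_of_S`, `B_of_lkg`): S hands B its
   hypothesis at EVERY exceptional admissible datum. Hence ONE admissible exceptional datum without a local good exit
   refutes B given S (`B_false_of_noLocalExit_of_S`), and the birth refuter's restatement `B₀ := S → LKG` is, under
   the construction target H₀ of §1, literally `¬S` (`B0_iff_notS_of_existsLocallyIncurable`).
3. **Negative lemma modulo H₀** (landing as `Theorems/TameExitsLocalise/Negative/TameExitsLocaliseFalseOfExistsLocallyIncurable.lean`):
   `H₀ := ExistsLocallyIncurable` (some admissible datum all of whose compactly supported admissible modifications are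
   exceptional) gives `H₀ → S → ¬B` and `H₀ → B → ¬S` (§1). H₀ is the first half of the lead's
   `ExistsIncurableTameExit` (p165912); the second half ("its receding tame smoothings are GOOD", print-open large-data
   statement (β)) is replaced by S. Under H₀ crux B alone negates the summit: B is summit-hard or false.
4. **Load-bearing hypotheses** (§2): TAMENESS of the exit family is the only hypothesis separating B from the
   A-refuted local-kick genericity — without joint smoothness / `wDist`-continuity the exit hypothesis holds at every
   exceptional datum as soon as one injective curve of good admissible data exists (`bRough_iff_lkg_of_goodCurves`);
   `¬Good d⋆` dropped ⇒ adds only local OPENNESS of goodness along a curve (plausible, untestable here); immersion and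
   injectivity in the CONCLUSION are decoration for both the route (`closes` discards them) and the refutation
   (`bMinus_false_of_existsLocallyIncurable_of_S`).
5. **The witness programme and its kinematics** (§3): the census datum `d_GO` (far train of thin high-frequency
   incoming GW shells, DR-admissible because `r³|∂²h| → 0` leaves the frequency free) should be built in k2's
   **Design T** — fold caustics of unit invariant curvature on TIMELIKE rays `t = 2r` — not in Design A (`t = 0.9 r`):
   for Design T the kinematic step "no late certified slab has all foci in its causal past" is the elementary
   `no_lipschitz_slice_above_superluminal_events` (checked), while for Design A it is void
   (`cone_slice_above_subluminal_events`, checked: the cone IS a Lipschitz slice above all foci) and must be replaced by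
   the slab/FOLIATION-rigidity heuristic of `SlabRigidityNote.md`, which this seat tried and FAILED to make rigorous:
   a disc-plus-corrugated-skirt foliation (flat disc `t = τ`, `|x| ≤ 1.1 τ`; zig-zag skirt of `0.99`-boosted facets
   `22°` off radial hugging `t ≳ 0.9 r` beyond; flatness defect `δ(τ) = 136/τ`) meets every constraint checked —
   crease width `3.58/δ(τ) = 0.026 τ ≤` sector width `0.05 r`, unit lapse with the skirt rising at `0.141 c`,
   Eulerian acceleration `≤ δ`, facet-crossing time `0.018 r ≳` re-boost time `0.02 τ` — with `O(1)` margins only; no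
   contradiction found. Causal bookkeeping of Design T against the TYPED `Good` (§3 docstrings): foci `∈ O` by
   `RaysStayInClosure`; `HasExhaustiveCharts` + `C²`-convergence on certified slabs put all foci in `J⁻` of ONE late
   certified slab; hole pieces catch finitely many; the flat piece is far out an achronal `(1+o(1))`-Lipschitz graph.
   Type-N loophole (chart frames boosted along a single incoming wave redshift it away) is closed by full-sphere /
   multi-directional implosions: the INVARIANT focal strength `inf_frames max |R_abcd| ≍ 1`.
6. **Picked line `IdeatorK2Sketch` (lead: dead)** (§4): `GoodnessTailRobust` (birth S2) and `BadnessTransfer` (k2 T2)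
   are both false modulo `H₀ᴺᴷᵀ ∧ S ∧ ParametricTailGluing` (checked: `goodnessTailRobust_false_of`,
   `badnessTransfer_false_of`; with S1 landed, modulo `H₀ᴺᴷᵀ ∧ S ∧ ChruscielDelay_parametricAnnulusGluing`), where
   `H₀ᴺᴷᵀ` adds "no Killing tail on any end chart" (true for `d_GO`: annuli straddling a shell carry no KID). So no
   line through "goodness survives tail surgery at a dirty-tailed `d⋆`" proves B as typed; `KillingTailCase` (S3) is
   untouched by `d_GO` (its hypothesis `¬NoKillingTail` excludes it) and no charge-pinning witness against it was found
   (B needs SOME local exit, not a localisation of the given one; `(M, J)` of an exact Kerr end pin nothing about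
   goodness of the cores gluable to it).
7. **Repairs**: `TameExitsLocaliseSmooth` / `…KerrEnded` (strategist) evade every mechanism here (tail-smooth far
   fields carry no caustics: `K_focus ≲ r⁴Aω³/r³ → 0`); this seat has no attack on them beyond S3.
-/

set_option linter.dupNamespace false
set_option linter.unusedVariables false

noncomputable section

namespace Summit.FinalStateConjecture.FinalStateConjecture.Cruxes.TameExitsLocalise.Disproof

open scoped Manifold ContDiff Topology
open Set Filter Literature.Geometry.Lorentzian
open Summit.FinalStateConjecture.FinalStateConjecture.Theses.LaminatedThreshold
open Summit.FinalStateConjecture.FinalStateConjecture.Cruxes.TameExitsLocalise.Birth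
open Summit.FinalStateConjecture.FinalStateConjecture.Cruxes.TameExitsLocalise.BadnessTransfer
open Summit.FinalStateConjecture.FinalStateConjecture.Theorems.TameExitsLocalise.Negative

/-! ## §0 Vocabulary (definitional foldings of the crux's clauses; `Good` is the birth line's) -/

section Vocabulary

variable {X : Type} [TopologicalSpace X] [ChartedSpace E3 X] [IsManifold (𝓡 3) ∞ X] [T2Space X]
  [SecondCountableTopology X] [ConnectedSpace X]

/-- B's hypothesis at `d⋆`: a tame, immersed, injective, admissible exit with good members `c ≠ 0`. -/
def TameExit (dstar : InitialDataSet (𝓡 3) X) : Prop :=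
  ∃ (e : AFEnd X) (F : EuclideanSpace ℝ (Fin 1) → InitialDataSet (𝓡 3) X),
    InitialDataSet.IsTameDataFamily e 1 F ∧ InitialDataSet.IsImmersedAtZero 1 F ∧ F 0 = dstar ∧
    Function.Injective F ∧ (∀ c, F c ∈ admissibleVacuumData X) ∧ ∀ c, c ≠ 0 → Good (F c)

/-- B's conclusion at `d⋆`: a compactly supported smooth immersed injective admissible exit, good on a punctured
window. -/
def LocalExit (dstar : InitialDataSet (𝓡 3) X) : Prop :=
  ∃ F' : EuclideanSpace ℝ (Fin 1) → InitialDataSet (𝓡 3) X,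
    InitialDataSet.IsSmoothDataFamily 1 F' ∧ InitialDataSet.IsImmersedAtZero 1 F' ∧ F' 0 = dstar ∧
    Function.Injective F' ∧ (∀ c, F' c ∈ admissibleVacuumData X) ∧
    (∃ C : Set X, IsCompact C ∧
      ∀ c, ∀ x ∉ C, (F' c).h.inner x = dstar.h.inner x ∧ (F' c).k x = dstar.k x) ∧
    ∃ ε : ℝ, 0 < ε ∧ ∀ c, c ≠ 0 → ‖c‖ < ε → Good (F' c)

/-- The same conclusion WITHOUT immersion and injectivity (what `closes` actually consumes). -/
def LocalExitMinus (dstar : InitialDataSet (𝓡 3) X) : Prop :=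
  ∃ F' : EuclideanSpace ℝ (Fin 1) → InitialDataSet (𝓡 3) X,
    InitialDataSet.IsSmoothDataFamily 1 F' ∧ F' 0 = dstar ∧ (∀ c, F' c ∈ admissibleVacuumData X) ∧
    (∃ C : Set X, IsCompact C ∧
      ∀ c, ∀ x ∉ C, (F' c).h.inner x = dstar.h.inner x ∧ (F' c).k x = dstar.k x) ∧
    ∃ ε : ℝ, 0 < ε ∧ ∀ c, c ≠ 0 → ‖c‖ < ε → Good (F' c)

/-- The topology-free exit: an injective admissible family through `d⋆` with good members `c ≠ 0`, NO joint
smoothness, NO end, NO `wDist`-continuity (the older `IsChristodoulouGeneric` shape). -/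
def RoughExit (dstar : InitialDataSet (𝓡 3) X) : Prop :=
  ∃ F : EuclideanSpace ℝ (Fin 1) → InitialDataSet (𝓡 3) X,
    F 0 = dstar ∧ Function.Injective F ∧ (∀ c, F c ∈ admissibleVacuumData X) ∧ ∀ c, c ≠ 0 → Good (F c)

/-- `d⋆` is LOCALLY INCURABLE: every admissible datum agreeing with it off some compact set is exceptional. -/
def LocallyIncurable (dstar : InitialDataSet (𝓡 3) X) : Prop :=
  ∀ C : Set X, IsCompact C → ∀ d' ∈ admissibleVacuumData X,
    (∀ x ∉ C, d'.h.inner x = dstar.h.inner x ∧ d'.k x = dstar.k x) → ¬ Good d'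

omit [TopologicalSpace X] [ChartedSpace E3 X] [IsManifold (𝓡 3) ∞ X] [T2Space X] [SecondCountableTopology X]
  [ConnectedSpace X] in
/-- A non-zero parameter of norm `< ε` (the witness `(ε/2)·e₀` used throughout). -/
theorem exists_ne_zero_norm_lt {ε : ℝ} (hε : 0 < ε) :
    ∃ c : EuclideanSpace ℝ (Fin 1), c ≠ 0 ∧ ‖c‖ < ε := by
  set v : EuclideanSpace ℝ (Fin 1) := EuclideanSpace.single (0 : Fin 1) (1 : ℝ) with hv
  have hnv : ‖v‖ = 1 := by simp [hv]
  refine ⟨(ε / 2) • v, ?_, ?_⟩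
  · intro h0
    have : ‖(ε / 2) • v‖ = 0 := by rw [h0, norm_zero]
    rw [norm_smul, hnv, mul_one, Real.norm_eq_abs, abs_of_pos (by positivity)] at this
    linarith
  · rw [norm_smul, hnv, mul_one, Real.norm_eq_abs, abs_of_pos (by positivity)]
    linarith

omit [T2Space X] [SecondCountableTopology X] in
theorem localExitMinus_of_localExit {dstar : InitialDataSet (𝓡 3) X} (h : LocalExit dstar) :
    LocalExitMinus dstar := by
  obtain ⟨F', hF', -, h0, -, hadm, hC, hε⟩ := h
  exact ⟨F', hF', h0, hadm, hC, hε⟩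

omit [T2Space X] [SecondCountableTopology X] in
/-- Local incurability kills even the weak local exit. -/
theorem not_localExitMinus_of_locallyIncurable {dstar : InitialDataSet (𝓡 3) X}
    (hinc : LocallyIncurable dstar) : ¬ LocalExitMinus dstar := by
  rintro ⟨F', -, -, hadm, ⟨C, hC, hagree⟩, ε, hε, hgood⟩
  obtain ⟨c, hc0, hcε⟩ := exists_ne_zero_norm_lt hε
  exact hinc C hC (F' c) (hadm c) (hagree c) (hgood c hc0 hcε)

omit [T2Space X] [SecondCountableTopology X] in
theorem not_good_of_locallyIncurable {dstar : InitialDataSet (𝓡 3) X}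
    (hd : dstar ∈ admissibleVacuumData X) (hinc : LocallyIncurable dstar) : ¬ Good dstar :=
  hinc ∅ isCompact_empty dstar hd fun _ _ ↦ ⟨rfl, rfl⟩

end Vocabulary

/-- Local-kick genericity (window form): every admissible exceptional datum has a local good exit. -/
def LKG : Prop :=
  ∀ (X : Type) [TopologicalSpace X] [ChartedSpace E3 X] [IsManifold (𝓡 3) ∞ X] [T2Space X]
    [SecondCountableTopology X] [ConnectedSpace X],
    ∀ dstar ∈ admissibleVacuumData X, ¬ Good dstar → LocalExit dstar

/-- B with the decoration dropped from the conclusion. -/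
def BMinus : Prop :=
  ∀ (X : Type) [TopologicalSpace X] [ChartedSpace E3 X] [IsManifold (𝓡 3) ∞ X] [T2Space X]
    [SecondCountableTopology X] [ConnectedSpace X],
    ∀ dstar ∈ admissibleVacuumData X, ¬ Good dstar → TameExit dstar → LocalExitMinus dstar

/-- B with the exit hypothesis made topology-free (no tameness, no smoothness, no immersion). -/
def BRough : Prop :=
  ∀ (X : Type) [TopologicalSpace X] [ChartedSpace E3 X] [IsManifold (𝓡 3) ∞ X] [T2Space X]
    [SecondCountableTopology X] [ConnectedSpace X],
    ∀ dstar ∈ admissibleVacuumData X, ¬ Good dstar → RoughExit dstar → LocalExit dstar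

/-- One injective curve of good admissible data on every carrier that has exceptional data at all (physically:
`c ↦` Minkowskian data plus `(1 + c)`× a fixed small TT bump, good by Christodoulou–Klainerman; not provable here). -/
def GoodCurves : Prop :=
  ∀ (X : Type) [TopologicalSpace X] [ChartedSpace E3 X] [IsManifold (𝓡 3) ∞ X] [T2Space X]
    [SecondCountableTopology X] [ConnectedSpace X],
    (∃ d ∈ admissibleVacuumData X, ¬ Good d) →
      ∃ G : EuclideanSpace ℝ (Fin 1) → InitialDataSet (𝓡 3) X,
        Function.Injective G ∧ (∀ c, G c ∈ admissibleVacuumData X) ∧ ∀ c, Good (G c)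

/-- **Construction target H₀** (folded form of `Theorems.TameExitsLocalise.Negative.ExistsLocallyIncurable` of the
landing negative file; definitionally equal to it). -/
def ExistsLocallyIncurable : Prop :=
  ∃ (X : Type) (_ : TopologicalSpace X) (_ : ChartedSpace E3 X) (_ : IsManifold (𝓡 3) ∞ X) (_ : T2Space X)
    (_ : SecondCountableTopology X) (_ : ConnectedSpace X) (dstar : InitialDataSet (𝓡 3) X),
    dstar ∈ admissibleVacuumData X ∧ LocallyIncurable dstar

/-- **H₀ᴺᴷᵀ**: H₀ with, in addition, no Killing tail of the witness on any end chart (so that implicit-function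
annulus gluing is unobstructed; true for the shell train: choose annuli straddling a shell). -/
def ExistsLocallyIncurableNKT : Prop :=
  ∃ (X : Type) (_ : TopologicalSpace X) (_ : ChartedSpace E3 X) (_ : IsManifold (𝓡 3) ∞ X) (_ : T2Space X)
    (_ : SecondCountableTopology X) (_ : ConnectedSpace X) (dstar : InitialDataSet (𝓡 3) X),
    dstar ∈ admissibleVacuumData X ∧ LocallyIncurable dstar ∧ ∀ e : AFEnd X, NoKillingTail e dstar

/-! ## §1 Logical frame -/

/-- B, folded (definitional). -/
theorem B_iff :
    TameExitsLocalise ↔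
      ∀ (X : Type) [TopologicalSpace X] [ChartedSpace E3 X] [IsManifold (𝓡 3) ∞ X] [T2Space X]
        [SecondCountableTopology X] [ConnectedSpace X],
        ∀ dstar ∈ admissibleVacuumData X, ¬ Good dstar → TameExit dstar → LocalExit dstar :=
  Iff.rfl

/-- **S supplies B's hypothesis at every exceptional admissible datum** (tame Christodoulou-genericity unfolded). -/
theorem tameExit_of_S (hS : FinalStateConjecture) (X : Type) [TopologicalSpace X] [ChartedSpace E3 X]
    [IsManifold (𝓡 3) ∞ X] [T2Space X] [SecondCountableTopology X] [ConnectedSpace X]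
    (dstar : InitialDataSet (𝓡 3) X) (hd : dstar ∈ admissibleVacuumData X) (hbad : ¬ Good dstar) :
    TameExit dstar := by
  obtain ⟨e, F, hF, himm, h0, hinj, hadm, hexc⟩ := hS X dstar ⟨hd, hbad⟩
  exact ⟨e, F, hF, himm, h0, hinj, hadm, fun c hc ↦ by
    by_contra hP
    exact hexc c hc ⟨hadm c, hP⟩⟩

/-- **B ∧ S ⟹ local-kick genericity.** -/
theorem lkg_of_B_of_S (hB : TameExitsLocalise) (hS : FinalStateConjecture) : LKG :=
  fun X _ _ _ _ _ _ dstar hd hbad ↦ hB X dstar hd hbad (tameExit_of_S hS X dstar hd hbad)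

/-- … and conversely LKG ⟹ B outright: given S, crux B IS local-kick genericity. -/
theorem B_of_lkg (h : LKG) : TameExitsLocalise :=
  fun X _ _ _ _ _ _ dstar hd hbad _ ↦ h X dstar hd hbad

theorem B_iff_lkg_of_S (hS : FinalStateConjecture) : TameExitsLocalise ↔ LKG :=
  ⟨fun hB ↦ lkg_of_B_of_S hB hS, B_of_lkg⟩

/-- **Vacuity direction**: if no admissible datum is exceptional, B holds for lack of instances (and so does S; the
route then fails on crux A). B is vacuously true iff no exceptional admissible datum has a tame good exit. -/
theorem B_of_noExceptional
    (h : ∀ (X : Type) [TopologicalSpace X] [ChartedSpace E3 X] [IsManifold (𝓡 3) ∞ X] [T2Space X]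
      [SecondCountableTopology X] [ConnectedSpace X], ∀ d ∈ admissibleVacuumData X, Good d) :
    TameExitsLocalise :=
  fun X _ _ _ _ _ _ dstar hd hbad _ ↦ absurd (h X dstar hd) hbad

/-- **One exceptional admissible datum without a local exit refutes B, given S.** -/
theorem B_false_of_noLocalExit_of_S
    (h : ∃ (X : Type) (_ : TopologicalSpace X) (_ : ChartedSpace E3 X) (_ : IsManifold (𝓡 3) ∞ X)
      (_ : T2Space X) (_ : SecondCountableTopology X) (_ : ConnectedSpace X) (dstar : InitialDataSet (𝓡 3) X),
      dstar ∈ admissibleVacuumData X ∧ ¬ Good dstar ∧ ¬ LocalExit dstar)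
    (hS : FinalStateConjecture) : ¬ TameExitsLocalise := by
  intro hB
  obtain ⟨X, i₁, i₂, i₃, i₄, i₅, i₆, dstar, hd, hbad, hno⟩ := h
  exact hno (lkg_of_B_of_S hB hS X dstar hd hbad)

/-- H₀ alone refutes local-kick genericity (no S needed). -/
theorem not_lkg_of_existsLocallyIncurable (h : ExistsLocallyIncurable) : ¬ LKG := by
  intro hL
  obtain ⟨X, i₁, i₂, i₃, i₄, i₅, i₆, dstar, hd, hinc⟩ := h
  exact not_localExitMinus_of_locallyIncurable hinc
    (localExitMinus_of_localExit (hL X dstar hd (not_good_of_locallyIncurable hd hinc)))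

/-- **Negative lemma modulo H₀ (given S).** -/
theorem B_false_of_existsLocallyIncurable_of_S (h : ExistsLocallyIncurable) (hS : FinalStateConjecture) :
    ¬ TameExitsLocalise :=
  fun hB ↦ not_lkg_of_existsLocallyIncurable h (lkg_of_B_of_S hB hS)

/-- **Permuted: under H₀, crux B alone negates the summit.** -/
theorem not_S_of_existsLocallyIncurable_of_B (h : ExistsLocallyIncurable) (hB : TameExitsLocalise) :
    ¬ FinalStateConjecture :=
  fun hS ↦ B_false_of_existsLocallyIncurable_of_S h hS hB

/-- H₀ is the first half of the lead's construction target (p165912). -/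
theorem existsLocallyIncurable_of_lead (h : ExistsIncurableTameExit) : ExistsLocallyIncurable := by
  obtain ⟨X, i₁, i₂, i₃, i₄, i₅, i₆, dstar, hd, hinc, -⟩ := h
  exact ⟨X, i₁, i₂, i₃, i₄, i₅, i₆, dstar, hd, hinc⟩

/-- The folded H₀ is definitionally the landing file's `…Negative.ExistsLocallyIncurable` (stated against the
inline expansion to keep this file independent of the pending proposal). -/
theorem existsLocallyIncurable_iff_inline :
    ExistsLocallyIncurable ↔
      ∃ (X : Type) (_ : TopologicalSpace X) (_ : ChartedSpace E3 X) (_ : IsManifold (𝓡 3) ∞ X)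
        (_ : T2Space X) (_ : SecondCountableTopology X) (_ : ConnectedSpace X) (dstar : InitialDataSet (𝓡 3) X),
        dstar ∈ admissibleVacuumData X ∧ ∀ C : Set X, IsCompact C → ∀ d' ∈ admissibleVacuumData X,
          (∀ x ∉ C, d'.h.inner x = dstar.h.inner x ∧ d'.k x = dstar.k x) →
            ¬ ((∃ 𝒟 : VacuumCauchyDevelopment d', 𝒟.IsMaximal) ∧
                ∀ 𝒟 : VacuumCauchyDevelopment d', 𝒟.IsMaximal →
                  Summit.FinalStateConjecture.HasCompleteNullInfinity 𝒟.toCauchyDevelopment ∧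
                    ∃ (O : Set 𝒟.carrier) (d : FinalStateDecomposition 𝒟.toSpacetime O 2),
                      (∀ i, Kerr.IsSubextremal (d.mass i) (d.spin i)) ∧
                        O = Summit.FinalStateConjecture.exteriorOf 𝒟.toCauchyDevelopment d.charted ∧
                          Summit.FinalStateConjecture.RaysStayInClosure 𝒟.toCauchyDevelopment O ∧
                            Summit.FinalStateConjecture.HasExhaustiveCharts d ∧
                              Summit.FinalStateConjecture.IsFutureOriented d) :=
  Iff.rfl

/-- **The recommended weak restatement `B₀ := S → LKG` is `¬S` under H₀.** (`B → B₀` is `lkg_of_B_of_S`;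
`A → B₀ → ¬S` is the birth refuter's `closes_of_weakCrux`.) -/
theorem B0_iff_notS_of_existsLocallyIncurable (h : ExistsLocallyIncurable) :
    (FinalStateConjecture → LKG) ↔ ¬ FinalStateConjecture :=
  ⟨fun hB0 hS ↦ not_lkg_of_existsLocallyIncurable h (hB0 hS), fun hnS hS ↦ absurd hS hnS⟩

/-- **Crux A makes B and S jointly inconsistent** (= `closes`, permuted): the lamination datum of A is itself an
exceptional admissible datum without local exit, so A → ¬LKG and A ∧ S → ¬B. -/
theorem B_false_of_A_of_S (hA : LaminatedThreshold) (hS : FinalStateConjecture) : ¬ TameExitsLocalise :=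
  fun hB ↦ closes hA hB hS

/-! ## §2 Load-bearing hypotheses

* **Tameness / joint smoothness of the exit** (`IsTameDataFamily`): THE load-bearing hypothesis. Replace the tame
  exit by a topology-free one and B becomes LKG (`bRough_iff_lkg_of_goodCurves`), refuted by A alone and by H₀ alone.
  So any proof of B must use that `F c → d⋆` in `wDist` / jointly smoothly — i.e. CONTINUITY of the exit at `d⋆` in
  the weighted `C²₋₁ × C¹₋₂` topology, which controls exactly `r|h̃|, r²|∂h̃|, r³|∂²h̃|, r²|k|, r³|∂k|` and nothing of
  higher order: the geometric-optics focusing gain `rω` is invisible to it (census §Negation). This is why B as typed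
  is false at a dirty-tailed datum (modulo H₀ ∧ S) and why the tail-smooth repair evades the mechanism.
* **`¬Good d⋆`**: dropping it asks in addition that goodness be OPEN along some immersed local curve at good data
  with tame exits — Cauchy stability + asymptotic stability of the settled state; plausible, not attackable here.
* **Immersion / injectivity of the conclusion**: decoration (`bMinus_false_of_existsLocallyIncurable_of_S` below and
  `closes`); of the hypothesis: weakening them strengthens B harmlessly.
* **Admissibility of all members `∀ c`** and injectivity on all of `ℝ¹`: harmless by radial contraction
  (`exists_tameFamily_of_localWindow` pattern; birth-vetting note).
-/

theorem bMinus_of_B (hB : TameExitsLocalise) : BMinus :=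
  fun X _ _ _ _ _ _ dstar hd hbad hex ↦ localExitMinus_of_localExit (hB X dstar hd hbad hex)

/-- The refutation modulo H₀ ∧ S does not exploit immersion/injectivity of B's conclusion. -/
theorem bMinus_false_of_existsLocallyIncurable_of_S (h : ExistsLocallyIncurable) (hS : FinalStateConjecture) :
    ¬ BMinus := by
  intro hB
  obtain ⟨X, i₁, i₂, i₃, i₄, i₅, i₆, dstar, hd, hinc⟩ := h
  have hbad := not_good_of_locallyIncurable hd hinc
  exact not_localExitMinus_of_locallyIncurable hinc (hB X dstar hd hbad (tameExit_of_S hS X dstar hd hbad))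

theorem B_of_bRough (h : BRough) : TameExitsLocalise :=
  fun X _ _ _ _ _ _ dstar hd hbad ⟨_, F, _, _, h0, hinj, hadm, hgood⟩ ↦
    h X dstar hd hbad ⟨F, h0, hinj, hadm, hgood⟩

/-- **Without tameness B is local-kick genericity**: given one injective curve of good admissible data, the
topology-free exit hypothesis holds at EVERY exceptional admissible datum (redefine the curve at `c = 0` to be `d⋆`),
so `BRough ↔ LKG`. -/
theorem bRough_iff_lkg_of_goodCurves (hG : GoodCurves) : BRough ↔ LKG := by
  classical
  refine ⟨fun hR X _ _ _ _ _ _ dstar hd hbad ↦ ?_, fun hL X _ _ _ _ _ _ dstar hd hbad _ ↦ hL X dstar hd hbad⟩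
  obtain ⟨G, hGinj, hGadm, hGgood⟩ := hG X ⟨dstar, hd, hbad⟩
  refine hR X dstar hd hbad ⟨fun c ↦ if c = 0 then dstar else G c, by simp, ?_, ?_, ?_⟩
  · intro a b hab
    by_cases ha : a = 0 <;> by_cases hb : b = 0
    · rw [ha, hb]
    · simp only [ha, hb, if_true, if_false] at hab
      exact absurd (hab ▸ hGgood b) hbad
    · simp only [ha, hb, if_true, if_false] at hab
      exact absurd (hab ▸ hGgood a) hbad
    · simp only [ha, hb, if_false] at hab
      exact hGinj hab
  · intro c
    by_cases hc : c = 0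
    · simp only [hc, if_true]; exact hd
    · simp only [hc, if_false]; exact hGadm c
  · intro c hc
    simp only [hc, if_false]
    exact hGgood c

/-! ## §3 The witness programme: Design T, causal bookkeeping, kinematics

**Intended H₀-witness (k2's Design T of the census datum).** `X = ℝ³`; conformally glued vacuum data = Minkowskian
(or Schwarzschild-cored) data plus, for `n ≥ 1`, `Jₙ ≍ n²` thin incoming linearised-GW shells (time-reversed compact
bursts, so the implosion is multi-directional), shell `(n,j)` of radius `2rₙ` about `xₙⱼ = rₙ ωₙⱼ` at `t = 0`
(`rₙ = 100ⁿ r₁`, `{ωₙⱼ}` a `1/n`-net of `S²`), amplitude `Aₙ`, frequency `ωₙ`, corrected to exact constraint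
solutions by far-annulus gluing. ADMISSIBILITY: shell `n` sits at radii `∈ [rₙ, 3rₙ]`, so DR needs
`27 rₙ³ Aₙ ωₙ² =: ηₙ → 0` (and weaker first/zeroth-order conditions); completeness, one end, smoothness: clear;
local finiteness from `rₙ₊₁ = 100 rₙ`. FOCI: designed as fold caustics near `(t, x) = (2rₙ, rₙωₙⱼ)` with gain
`(ωₙ rₙ)^{1/6}`, invariant curvature strength `≍ Aₙωₙ²(ωₙrₙ)^{1/6} ≥ 1` iff `ωₙ ≳ rₙ¹⁷/ηₙ⁶` — the frequency is FREE
in the DR class, so this is compatible with `ηₙ → 0`. Caustics are structurally stable, so the weak smooth far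
field of ANY compactly supported modification (mass `M'`, radiation `O(M'/rₙ)`) moves but does not remove them for
`n ≥ n₀(d')`; nonlinearity parameter at a focus `≍ ωₙ⁻² ≪ 1` (no trapping far out).

**Why unit-curvature events escaping to `i⁺` inside the DOC defeat `Good d'` AS TYPED**, for every MGHD (unique)
and every witness `(O, d)`:
1. `p ∈ O = J⁺(Σ) ∩ I⁻(charted)`: the outgoing radial null ray from `(0, 0.05 rₙ ω)` is future complete and enters
   `I⁺(p)`; by `RaysStayInClosure` it lies in `closure O ⊆ closure I⁻(charted)`, and `I⁻(closure I⁻ U) = I⁻ U`.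
2. `C²`-smallness of `Ψ^*g − η` (resp. `− g_{M,a}`) at a certified slab point bounds the invariant strength
   `inf_frames max|R_abcd|` there by `O(δ)`; so from some chart time `τ₁` on no focus is certified-late, and
   `HasExhaustiveCharts` gives `p ∈ J⁻(certifiedSlab τ₁)` for EVERY focus. Hole pieces
   `Ψᵢ{t* = τ₁, r₊ < r ≤ Rᵢ(τ₁)}` are near-isometric images of compact-closure Kerr pieces; `J⁻(compact) ∩ J⁺(Σ)` is
   compact, catching finitely many foci. So cofinitely many foci lie in `J⁻(S)`, `S := Ψ₀{x⁰ = τ₁}`.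
3. `S` is complete (chart metric `(1 ± ε)`-Euclidean on all of `ℝ³`), hence over the far region an entire graph
   `t = u(x)`, `u` `K`-Lipschitz for the far cones, `K = 1 + O(M/ρ₀)` beyond radius `ρ₀` (Shapiro). A focus
   `(2rₙ, rₙω) ∈ J⁻(S)` forces `u(y) ≥ |y| + rₙ(1 − o(1))` at some far `y`; `no_lipschitz_slice_above_superluminal_events`
   (with `s = 2`, or in the form `u(y) − K|y| → ∞`) is the contradiction. NO statement about the intrinsic geometry of
   late slabs or foliations is used.
For Design A (`t = 0.9 r`, outside the domain of influence of every compact set — which made local incurability a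
pure domain-of-dependence statement) step 3 fails: `cone_slice_above_subluminal_events`. The price of Design T is that
compact modifications DO influence the foci, paid by caustic stability (k2's negative-side note, crux item notes
2026-08-17). FOLIATION RIGIDITY (lead's `SlabRigidityNote.md` §2, "disprover-wanted: make §2 rigorous"): NOT
CONFIRMED — see the module docstring, item 5, for the candidate counter-foliation and the margins; treat §2 as open and
unnecessary.
-/

/-- **No Lipschitz slice lies above receding superluminally-timed events** (kinematic core of Design T). -/
theorem no_lipschitz_slice_above_superluminal_events {E : Type*} [SeminormedAddCommGroup E] {K : NNReal}
    {u : E → ℝ} (hu : LipschitzWith K u) {s : ℝ} (hs : (K : ℝ) < s) {x : ℕ → E}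
    (hx : Tendsto (fun n ↦ ‖x n‖) atTop atTop) (habove : ∀ n, s * ‖x n‖ ≤ u (x n)) : False := by
  obtain ⟨n, hn⟩ := (hx.eventually_gt_atTop (u 0 / (s - K))).exists
  have hlip := hu.dist_le_mul (x n) 0
  rw [dist_zero_right, Real.dist_eq] at hlip
  have h1 : u (x n) ≤ u 0 + K * ‖x n‖ := by
    have := le_abs_self (u (x n) - u 0)
    linarith
  have h2 := habove n
  have hsK : 0 < s - K := by linarith
  have h3 : ‖x n‖ ≤ u 0 / (s - K) := by
    rw [le_div_iff₀ hsK]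
    nlinarith [h1, h2]
  linarith

/-- The same in "excess" form: along receding points a `K`-Lipschitz `u` cannot exceed `K‖·‖` by unbounded amounts
(the form used with Shapiro-corrected cones: `u(y) ≥ K|y| + rₙ(1-o(1))`). -/
theorem no_lipschitz_slice_with_unbounded_excess {E : Type*} [SeminormedAddCommGroup E] {K : NNReal}
    {u : E → ℝ} (hu : LipschitzWith K u) {x : ℕ → E} {b : ℕ → ℝ} (hb : Tendsto b atTop atTop)
    (habove : ∀ n, K * ‖x n‖ + b n ≤ u (x n)) : False := by
  obtain ⟨n, hn⟩ := (hb.eventually_gt_atTop (u 0)).exists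
  have hlip := hu.dist_le_mul (x n) 0
  rw [dist_zero_right, Real.dist_eq] at hlip
  have h1 : u (x n) ≤ u 0 + K * ‖x n‖ := by
    have := le_abs_self (u (x n) - u 0)
    linarith
  have h2 := habove n
  linarith

/-- **Tightness for Design A**: subluminally-timed events (`s ≤ 1`) all lie under the Lipschitz cone `u = ‖·‖`. -/
theorem cone_slice_above_subluminal_events {E : Type*} [SeminormedAddCommGroup E] {s : ℝ} (hs : s ≤ 1) :
    ∃ u : E → ℝ, LipschitzWith 1 u ∧ ∀ x : E, s * ‖x‖ ≤ u x :=
  ⟨fun x ↦ ‖x‖, lipschitzWith_one_norm, fun x ↦ mul_le_of_le_one_left (norm_nonneg x) hs⟩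

/-! ## §4 Targets — the picked line `IdeatorK2Sketch` (and birth S2)

No `targets`/`stuck_stubs` were served (the lead declared the line dead, `Lines/IdeatorK2SketchDead.md`). Recorded for
the tenure planner: the two "goodness survives tail surgery" stubs die at the SAME datum as B, by the same one-line
mechanism, as soon as the glued local family exists (S1, landed modulo the Chruściel–Delay fact). -/

/-- **Birth S2 `GoodnessTailRobust` is false modulo `H₀ᴺᴷᵀ ∧ S ∧ S1`.** S gives the tame good exit `F` at the
incurable `d⋆`; S2 gives a threshold `R⋆`; S1 glues a local family `F'` agreeing with `F c` inside some `R₁ ≥ R⋆`;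
S2 declares `F'` good on a window; incurability says its members are exceptional. -/
theorem goodnessTailRobust_false_of (h : ExistsLocallyIncurableNKT) (hS : FinalStateConjecture)
    (hglue : ParametricTailGluing) : ¬ GoodnessTailRobust := by
  intro hrobust
  obtain ⟨X, i₁, i₂, i₃, i₄, i₅, i₆, dstar, hd, hinc, hNKT⟩ := h
  have hbad := not_good_of_locallyIncurable hd hinc
  obtain ⟨e, F, hF, himm, h0, hinj, hadm, hgood⟩ := tameExit_of_S hS X dstar hd hbad
  obtain ⟨Rstar, hR⟩ := hrobust X e dstar F hd hF h0 hadm hgood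
  obtain ⟨R₁, hR₁, F', ε₁, hF', himm', h0', hinj', hadm', hC', hε₁, hcore⟩ :=
    hglue X e dstar F hd hF himm h0 hinj hadm (hNKT e) Rstar
  obtain ⟨ε, hε, hwin⟩ := hR R₁ hR₁ F' hF' h0' hadm' hC' ⟨ε₁, hε₁, hcore⟩
  exact not_localExitMinus_of_locallyIncurable hinc ⟨F', hF', h0', hadm', hC', ε, hε, hwin⟩

/-- **k2 T2 `BadnessTransfer` is false modulo `H₀ᴺᴷᵀ ∧ S ∧ S1`** (same mechanism: the glued `L := F'` has BAD
members, which T2 transfers to the GOOD exit members). -/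
theorem badnessTransfer_false_of (h : ExistsLocallyIncurableNKT) (hS : FinalStateConjecture)
    (hglue : ParametricTailGluing) : ¬ BadnessTransfer := by
  intro hBT
  obtain ⟨X, i₁, i₂, i₃, i₄, i₅, i₆, dstar, hd, hinc, hNKT⟩ := h
  have hbad := not_good_of_locallyIncurable hd hinc
  obtain ⟨e, F, hF, himm, h0, hinj, hadm, hgood⟩ := tameExit_of_S hS X dstar hd hbad
  obtain ⟨Rstar, hR⟩ := hBT X e dstar F hd hbad hF himm h0 hinj hadm hgood (hNKT e)
  obtain ⟨R₁, hR₁, F', ε₁, hF', himm', h0', hinj', hadm', hC', hε₁, hcore⟩ :=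
    hglue X e dstar F hd hF himm h0 hinj hadm (hNKT e) Rstar
  obtain ⟨ε, hε, hwin⟩ := hR R₁ hR₁ F' hF' h0' hadm' hC' ⟨ε₁, hε₁, hcore⟩
  obtain ⟨C, hC, hagree⟩ := hC'
  obtain ⟨c, hc0, hcε⟩ := exists_ne_zero_norm_lt hε
  exact hwin c hc0 hcε (hinc C hC (F' c) (hadm' c) (hagree c)) (hgood c hc0)

/-- With S1 landed from the named fact (`coreTailGluing`): both stubs false modulo
`H₀ᴺᴷᵀ ∧ S ∧ ChruscielDelay_parametricAnnulusGluing`. -/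
theorem tailSurgeryStubs_false_of (h : ExistsLocallyIncurableNKT) (hS : FinalStateConjecture)
    (hCD : ChruscielDelay_parametricAnnulusGluing) : ¬ GoodnessTailRobust ∧ ¬ BadnessTransfer :=
  ⟨goodnessTailRobust_false_of h hS (coreTailGluing hCD), badnessTransfer_false_of h hS (coreTailGluing hCD)⟩

theorem existsLocallyIncurable_of_NKT (h : ExistsLocallyIncurableNKT) : ExistsLocallyIncurable := by
  obtain ⟨X, i₁, i₂, i₃, i₄, i₅, i₆, dstar, hd, hinc, -⟩ := h
  exact ⟨X, i₁, i₂, i₃, i₄, i₅, i₆, dstar, hd, hinc⟩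

/-! ## §5 Natural strengthenings / weakenings (status)

* `B₀ := S → LKG` (weaker): equivalent to `¬S` under H₀ (§1); adopting it makes the crux the summit's negation.
* `BMinus` (weaker conclusion): refuted modulo H₀ ∧ S exactly like B (§2).
* `BRough` (weaker hypothesis ⇒ stronger crux): `= LKG` given one good curve; refuted by A alone (§2, `closes`).
* `TameExitsLocaliseSmooth` / `TameExitsLocaliseKerrEnded` (strategist's repairs, stronger hypotheses on `d⋆`):
  untouched by every mechanism in this file; their content is threshold locality + (multi-)Kerr asymptotic
  stability + the Killing-tail case. No finite / decidable instance of any of these statements exists (no `decide`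
  targets): the only computations possible are the kinematic ones of §3.
-/

/-! ## §6 What an unconditional kill needs; near-miss -/

/-- **NEAR-MISS (the whole remaining gap): construct the H₀-witness.** Obstruction: the tree has no vacuum
development theory for explicit large data — needed are (i) the conformal/gluing construction of the Design-T shell
train inside `admissibleVacuumData ℝ³` (elliptic, standard in kind: far-annulus gluing is vendored as
`MaoOhTao.ObstructionFreeAnnularGluing` / `ChruscielDelay_localConstraintDeformation` patterns, but the countable
assembly with DR decay bookkeeping is not); (ii) high-frequency geometric optics with fold caustics for the vacuum
Einstein equations in the weak far field up to times `≍ rₙ`, uniformly in `n`, for the datum AND for every compactly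
supported admissible modification (nearest print: Touati, arXiv:2206.12318, local in time; Luk–Rodnianski impulsive
waves; none covers the semi-global weak-field regime needed, though it is physically unproblematic:
nonlinearity `≍ ωₙ⁻²`); (iii) MGHD existence for these data (Choquet-Bruhat–Geroch, not formalised) so that
"every MGHD" is not vacuous — NOTE: `¬Good d'` holds trivially if NO MGHD exists, so (iii) is needed only to make the
refutation honest, not for the Lean proof of `LocallyIncurable`, which needs: for every MGHD, failure of (complete
`𝓘⁺` ∧ decomposition); it suffices to defeat the decomposition, §3 steps 1–3, inside Lean's `FinalStateDecomposition`
/ `HasExhaustiveCharts` / `RaysStayInClosure` (causal theory of the development: `J⁻(compact) ∩ J⁺(Σ)` compact,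
limit-curve arguments — none of it in the tree). Tried this session: junk inhabitants of the hypothesis (none: see
module docstring item 1); decidable/small instances (none exist); dropping hypotheses (§2); the kinematic reductions
(§3, checked). -/
theorem existsLocallyIncurable : ExistsLocallyIncurable := by
  sorry

/-- What the near-miss would buy (kernel-checked composition): B false given S, S false given B. -/
theorem B_false_of_S_of_nearMiss (hS : FinalStateConjecture) : ¬ TameExitsLocalise :=
  B_false_of_existsLocallyIncurable_of_S existsLocallyIncurable hS

end Summit.FinalStateConjecture.FinalStateConjecture.Cruxes.TameExitsLocalise.Disproof

end
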